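import Summits.CriticalPhenomena.PercolationContinuityZ3.Theorems.PercNearOneGluingNoHeavyPcintKernSymZ6S5Defs
import HarnessLib

/-!
# PCINT lane, kernel check 1/1 of the B2r window certificate `d = 6`, memory 5 (4-step windows, 20736 codes): codes `0 ≤ c < 20736`

Cell `prim-pcint`, seat `prim-pcint-2` (gen 2).  Collatz–Wielandt rows `10^5 · row ≤ 99999 · DEN · v` for the window codes in
`[0, 20736)`, by `decide +kernel` in chunks of `3000` codes (natural-number arithmetic only; `maxHeartbeats 0`).
Does NOT build on p205010.
-/

namespace Summit.CriticalPhenomena.PercolationContinuityZ3.Theorems.Pcint.Z6S5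

set_option maxHeartbeats 0 in
/-- Rows `0 ≤ c < 3000` of the certificate hold (normal forms only; binary-split scan). [folklore] -/
theorem chk_0_3000 : chk 0 3000 = true :=
  WinK.allRange_of_allRangeB (fuel := 20) (lo := 0) (len := 3000) (by decide +kernel)

set_option maxHeartbeats 0 in
/-- Rows `3000 ≤ c < 6000` of the certificate hold (normal forms only; binary-split scan). [folklore] -/
theorem chk_3000_6000 : chk 3000 6000 = true :=
  WinK.allRange_of_allRangeB (fuel := 20) (lo := 3000) (len := 3000) (by decide +kernel)

set_option maxHeartbeats 0 in
/-- Rows `6000 ≤ c < 9000` of the certificate hold (normal forms only; binary-split scan). [folklore] -/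
theorem chk_6000_9000 : chk 6000 9000 = true :=
  WinK.allRange_of_allRangeB (fuel := 20) (lo := 6000) (len := 3000) (by decide +kernel)

set_option maxHeartbeats 0 in
/-- Rows `9000 ≤ c < 12000` of the certificate hold (normal forms only; binary-split scan). [folklore] -/
theorem chk_9000_12000 : chk 9000 12000 = true :=
  WinK.allRange_of_allRangeB (fuel := 20) (lo := 9000) (len := 3000) (by decide +kernel)

set_option maxHeartbeats 0 in
/-- Rows `12000 ≤ c < 15000` of the certificate hold (normal forms only; binary-split scan). [folklore] -/
theorem chk_12000_15000 : chk 12000 15000 = true :=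
  WinK.allRange_of_allRangeB (fuel := 20) (lo := 12000) (len := 3000) (by decide +kernel)

set_option maxHeartbeats 0 in
/-- Rows `15000 ≤ c < 18000` of the certificate hold (normal forms only; binary-split scan). [folklore] -/
theorem chk_15000_18000 : chk 15000 18000 = true :=
  WinK.allRange_of_allRangeB (fuel := 20) (lo := 15000) (len := 3000) (by decide +kernel)

set_option maxHeartbeats 0 in
/-- Rows `18000 ≤ c < 20736` of the certificate hold (normal forms only; binary-split scan). [folklore] -/
theorem chk_18000_20736 : chk 18000 20736 = true :=
  WinK.allRange_of_allRangeB (fuel := 20) (lo := 18000) (len := 2736) (by decide +kernel)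

/-- Rows `0 ≤ c < 20736` of the certificate hold. [folklore] -/
theorem chkFile_1 : chk 0 20736 = true :=
  chk_split (chk_split (chk_split (chk_split (chk_split (chk_split chk_0_3000 chk_3000_6000) chk_6000_9000) chk_9000_12000) chk_12000_15000) chk_15000_18000) chk_18000_20736

end Summit.CriticalPhenomena.PercolationContinuityZ3.Theorems.Pcint.Z6S5
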